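import Literature.NumberTheory.Transcendental.KZCubicalCalculus
import Summits.KontsevichZagierPeriods.KontsevichZagierPeriods.Theorems.HurwitzMicroSectorsNormalFormPrincipleDimOneAssembly

/-!
# `StokesGeneration` (stmt-KontsevichZagierPeriods-3586) — line `fibrewise_stokes`, stub `stub_kernelAlgKInterval`

Registered stub W3 of the line `fibrewise_stokes` of the crux `StokesGeneration` (route
UnfoldedStokes; the crux is the KERNEL CONJECTURE of the Kontsevich–Zagier calculus,
`eval x = 0 ⇒ x ∈ relations`). This file records that **the crux's kernel form holds on the whole
dimension-one layer of rational integrands with real algebraic coefficients on the unit interval**: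
if `N = [(0,1), P/Q]` with `P, Q ∈ K[X]` (`K = algebraicClosure ℚ ℝ`, the real algebraic numbers),
`Q` without zeros on `[0,1]`, and the value of `N` vanishes, then `of N` is a Kontsevich–Zagier
relation.

This is a corollary of route HurwitzMicroSectors' landed dimension-one normal-form machinery
(namespace `Summit.KontsevichZagierPeriods.HurwitzMicroSectors.NormalFormPrinciple.PiBox.Dlog`):
* `nfD_of_algK`: the class of such an `N` modulo relations is a mixed normal form
  `[pt, r] + Σ Λ(uⱼ, cⱼ) + Σ T(t_l, d_l)` with real algebraic data (the carrier families being
  supplied by `exists_carrierA`, `exists_ptCarrierA`, `exists_angCarrier`);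
* `nfD_eq_zero_of_eval_eq_zero`: a mixed normal form with value `0` is the zero class (Baker's
  theorem, `baker_holds`, proved in the tree);
* `eval (of N) = N.value` (`eval_of`) and `QuotientAddGroup.eq_zero_iff`.

Sources: M. Kontsevich, D. Zagier, *Periods* (2001), §1.2 Conjecture 1; A. Baker, *Transcendental
Number Theory* (1975), Thm. 2.1. No definitions are introduced.
-/

noncomputable section

-- `Summit.KontsevichZagierPeriods.KontsevichZagierPeriods.…` is the tree's mandated layout (single-conjunct summit).
set_option linter.dupNamespace false

namespace Summit.KontsevichZagierPeriods.KontsevichZagierPeriods.Cruxes.StokesGeneration.FibrewiseStokes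

open MeasureTheory Set
open Literature.NumberTheory.Transcendental
open Literature.NumberTheory.Transcendental.KZ
open Literature.ModelTheory.ExponentialFields (IsSemialgebraic)

open Summit.KontsevichZagierPeriods.HurwitzMicroSectors.NormalFormPrinciple.PiBox.Dlog
  (nfD_of_algK nfD_eq_zero_of_eval_eq_zero exists_carrierA exists_ptCarrierA exists_angCarrier)

/-- **Registered stub `stub_kernelAlgKInterval`: the kernel form of the crux `StokesGeneration` on
the dimension-one real-algebraic rational layer.** A representation `N = [(0,1), P/Q]` with
`P, Q ∈ K[X]` (`K = algebraicClosure ℚ ℝ`), `Q` zero-free on `[0,1]`, and value `0` is a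
Kontsevich–Zagier relation: its class is a mixed normal form (`nfD_of_algK`) with value `0`, hence
zero by Baker (`nfD_eq_zero_of_eval_eq_zero`).
[cite: KontsevichZagier2001, §1.2 Conjecture 1] [cite: Baker1975, Thm 2.1] -/
theorem stub_kernelAlgKInterval :
    ∀ (P Q : Polynomial (algebraicClosure ℚ ℝ)), (∀ t ∈ Set.Icc (0:ℝ) 1, (Polynomial.aeval t Q : ℝ) ≠ 0) →
      ∀ (N : IntegralRep 1), N.domain = {x | x 0 ∈ Set.Ioo (0:ℝ) 1} →
      Set.EqOn N.integrand (fun x => (Polynomial.aeval (x 0) P : ℝ) / Polynomial.aeval (x 0) Q) N.domain →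
      N.value = 0 → of N ∈ relations := by
  classical
  intro P Q hQ N hNd hNi hv
  obtain ⟨RA, hR⟩ := exists_carrierA
  obtain ⟨ZA, hZ⟩ := exists_ptCarrierA
  obtain ⟨RG, hRG⟩ := exists_angCarrier
  obtain ⟨r, k, u, c, k', t, d, hr, hu1, hu, hc, ht0, ht, hd, hEq⟩ :=
    nfD_of_algK hR hZ hRG P Q hQ N hNd hNi
  exact (QuotientAddGroup.eq_zero_iff _).mp
    (nfD_eq_zero_of_eval_eq_zero hR hZ hRG (of N) hr hu1 hu hc ht0 ht hd hEq (by rw [eval_of, hv]))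

end Summit.KontsevichZagierPeriods.KontsevichZagierPeriods.Cruxes.StokesGeneration.FibrewiseStokes
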